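import Literature.MathematicalPhysics.QuantumFieldTheory.Balaban1983to89.B9Eq340TaxiTelescope

/-!
# `Balaban1983to89.B9Eq340TwoRouteHolonomy` — T. Bałaban, *Propagators for lattice gauge theories in a background field*, Commun. Math. Phys. **99** (1985) 389–434
# [Balaban1985BackgroundPropagators], (3.40) p. 397 with (3.3) p. 391 and (3.35) p. 396: THE HOLONOMY OF THE TWO TAXICAB ROUTES BETWEEN TWO SITES — moving a straight
# block of steps past a signed step path costs the plaquettes it sweeps (`norm_moveBlock_sub_one_le`), hence the staircase with the direction order REVERSED differs from
# def-Y's staircase by `‖U(Γ)·U(Γ′)⁻¹ − 1‖ ≤ Σ_{μ<ν} n_μ n_ν · δ` (`norm_twoRoute_sub_one_le`): print's «a shortest contour Γ_{x,x′}» is route-independent up to O(plaquette defect ×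
# area), the bridge between NODE 00's two transporter conventions (`parSymY` on sites — one route per unordered pair — and `parBY = parTaxiV` on bonds — one route per
# ORIENTED pair)

statement-level skeleton of published theorems with citation tags; proofs where landed; nothing here is a claim about the Yang–Mills mass gap

THE PRINT.  (3.40) p. 397: the covariant Hölder quotient transports with `U(Γ_{x,x′})`, «Γ_{x,x′} a shortest contour connecting points x and x′» — print fixes no route; any
two shortest lattice contours between near points differ by a product of plaquette variables, each within `O(1)Mα₀(Lʲη)^{−2}·η²` of `1` under (3.35) ((3.69) p. 404), and the
number of plaquettes swept is at most the square of the contour length.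

WHY THIS FILE (cell `pub-ymgap`, Track A node N06 [B9]; seat `pub-ymgap-dag-n06-c` g19, road R3 of the G′ Hölder layer of rows 20–21, dag-n06-d `DISPLAY-LEDGER-UF.md` §2).
NODE 00's record reads the site-sector Hölder quotients (the engine's probe pin `holderProbesSN∕SA … (𝔏 x).parS`, def-Y's `kernelFamilyS.h1`) with `parS = parSymY` — the
taxicab route of the lex-INCREASING orientation and its INVERSE for the other orientation — while the rows-20–21 classes and bond probes (`bHZPG (taxiS U)`, `bHZKPG (taxiB U)`,
`holderProbesKA … parBY`) read `parTaxiV` in EACH orientation.  On a lex-decreasing pair the two conventions transport along the two DIFFERENT taxicab staircases between the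
same endpoints (direction order `0,1,…,d` from one end = order `d,…,1,0` from the other).  THIS FILE bounds their discrepancy by the plaquettes in between, with n06-i's signed
step paths and lassos (`B9Eq340StepLasso`) as the toolkit:
* §1 ★★ `norm_moveBlock_sub_one_le` — for unitary-like bond variables, a signed step path `l` and a forward block `K = (κ,+)^n`:
  `‖U(l ++ K)·U(K ++ l)⁻¹ − 1‖ ≤ Σ_{t<n} stepDefect κ U l (w + t e_κ)` (induction on `n`; one step = one lasso `B9Eq340StepLasso.norm_stepLasso_sub_one_le`, conjugated by
  the unitary-like straight run); `norm_moveBlock_sub_one_le_of_rungs` (a bound `δ` on the plaquettes based at the sites of a predicate `Q` containing the swept rungs ⇒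
  `≤ n·|l|·δ`), `norm_moveBlock_sub_one_le_mul` (uniform `δ`).
* §2 `revNeg` (the reversed path, `U(−Γ) = U(Γ)⁻¹`: `stepRun_revNeg`, `stepEnd_revNeg`), `stepRun_blockBwd_eq_inv`, ★★ `norm_moveBlockBwd_sub_one_le_of_rungs` — the backward
  block by the identity `Θ⁻(w) = C⁻¹·Θ⁺(w − n e_κ)⁻¹·C`.
* §3 ★★ `norm_moveLeg_sub_one_le` — one leg of def-Y's taxicab (`legSteps`, either regime) moved past a path: `≤ |leg|·|l|·δ`, rungs localised ON the leg (`onArc_add_of_le ∕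
  onArc_sub_of_not_le`).
* §4 `taxiSteps_append`, `taxiSteps_reverse_cons`, `length_taxiSteps_reverse`; ★★★ `norm_twoRoute_sub_one_le` — for a duplicate-free direction list, the staircase from `x`
  towards `z` in the order `dirs` and the one in the REVERSED order satisfy `‖U(Γ)·U(Γ′)⁻¹ − 1‖ ≤ |Γ|²·δ`, `δ` a bound on the plaquette variables based in the coordinate box
  `{v : v_μ on the shorter arc from x_μ to z_μ ∀μ}` (induction on `dirs`: peel the first leg, move it past the reversed remainder with §3 — its rungs in the box by n06-i's
  `B9Eq340TaxiRungs.rungSites_taxiSteps` — conjugate, recurse at the leg's endpoint whose box is inside ours).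
* §5 `revNeg_legSteps`, `revNeg_taxiSteps`, ★★ `parTaxiV_rev_eq_inv` (no tie in any direction ⇒ `U(Γ_{x′,x})` IS the inverse of the reversed-order staircase from `x`),
  ★★★ `norm_parTaxiV_mul_parTaxiV_sub_one_le` ∕ `…_supDist` — `‖U(Γ_{x,x′})·U(Γ_{x′,x}) − 1‖ ≤ |Γ_{x,x′}|²·δ ≤ (d·|x − x′|_∞)²·δ`.
The consumers (Hölder probe majorants at `parSymY` ⟹ at `parTaxiV` plus a sup member carrying the plaquette scale `(|x − x′|∕Lʲ)²`, via
`B9Thm310CommutatorDataOfPlaquettes.plaquetteDefect_of_reg335P` and the level window of near pairs) are the sequel.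

HONEST SCOPE.  Elementary non-abelian Stokes bookkeeping on a finite torus over def-Y's transport letters (the no-tie hypothesis of §5 — each coordinate's two arcs have
different lengths — holds for every near pair, `|x − x′|_∞ < period∕2`; it is displayed, not discharged here); nothing of [B9] asserted; COUNT-NEUTRAL; N06 NOT discharged; one finite lattice at a time — nothing continuum, nothing about the mass gap.  Cell
`pub-ymgap` (HUMAN RULING D-0062), Track A node N06 [B9], seat `pub-ymgap-dag-n06-c` (g19), 2026-08-29; a NEW file; 1 `def` (`revNeg`), no `sorry`, no `axiom`, no `instance`, no `notation`.
-/

namespace Literature.MathematicalPhysics.QuantumFieldTheory.Balaban1983to89.B9Eq340TwoRouteHolonomy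

open Finset
open T4RelativeLadder (UnitaryLike norm_conj_sub_one_eq norm_inv_sub_one_le)
open B9BackgroundsKLevelV1 (CfgV1 shiftsV1)
open B9Eq39Adjoint (plaqU)
open Node00 (parFwdV parFwdV_succ parBwdV parBwdV_succ taxiLegV taxiRun parTaxiV iterate_shift_apply iterate_unshift_apply)
open B9Eq340ContourLasso (iterate_shift_shift_comm)
open B9Eq340TaxiForward (parFwdV_succ_right)
open B9Eq340LadderHolonomy (norm_mul_sub_one_le)
open B9Eq340StepLasso (stepRun stepEnd stepDefect stepLasso rungSites legSteps taxiSteps stepRun_append stepEnd_append stepDefect_append stepEnd_shift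
  unitaryLike_stepRun norm_stepLasso_sub_one_le stepRun_replicate_true stepEnd_replicate_true stepDefect_le_of_forall length_rungSites taxiSteps_congr)
open B10StarCount (shift_unshift unshift_shift)

noncomputable section

variable {P : Params} {𝔸 : Type} [NormedRing 𝔸]

/-! ## §1 Moving a forward block past a signed step path -/

/-- the endpoint of a forward `κ`-block is the `n`-fold shift. [cite: Balaban1985BackgroundPropagators, (3.40) p.397, bookkeeping] -/
theorem stepEnd_block (κ : Fin P.d) (n : ℕ) (w : Site P 0) :
    stepEnd (List.replicate n (κ, true)) w = (fun y : Site P 0 => y.shift κ)^[n] w :=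
  stepEnd_replicate_true κ n w

/-- translating the start `n` times translates the end `n` times. [cite: Balaban1985BackgroundPropagators, (3.1) p.390, bookkeeping] -/
theorem stepEnd_iterate_shift (κ : Fin P.d) (l : List (Fin P.d × Bool)) : ∀ (n : ℕ) (w : Site P 0),
    stepEnd l ((fun y : Site P 0 => y.shift κ)^[n] w) = (fun y : Site P 0 => y.shift κ)^[n] (stepEnd l w)
  | 0, _ => rfl
  | n + 1, w => by
    rw [Function.iterate_succ_apply', Function.iterate_succ_apply', stepEnd_shift, stepEnd_iterate_shift κ l n w]

/-- the path followed by the block, as a product. [cite: Balaban1985BackgroundPropagators, (3.3) p.391, bookkeeping] -/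
theorem stepRun_path_block (U : CfgV1 P 𝔸) (κ : Fin P.d) (l : List (Fin P.d × Bool)) (n : ℕ) (w : Site P 0) :
    stepRun U (l ++ List.replicate n (κ, true)) w = stepRun U l w * parFwdV U κ n (stepEnd l w) := by
  rw [stepRun_append, stepRun_replicate_true]

/-- the block followed by the path, as a product. [cite: Balaban1985BackgroundPropagators, (3.3) p.391, bookkeeping] -/
theorem stepRun_block_path (U : CfgV1 P 𝔸) (κ : Fin P.d) (l : List (Fin P.d × Bool)) (n : ℕ) (w : Site P 0) :
    stepRun U (List.replicate n (κ, true) ++ l) w = parFwdV U κ n w * stepRun U l ((fun y : Site P 0 => y.shift κ)^[n] w) := by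
  rw [stepRun_append, stepRun_replicate_true, stepEnd_block]

/-- a forward straight run of unitary-like bond variables is unitary-like. [cite: Balaban1985BackgroundPropagators, (3.3) p.391, bookkeeping] -/
theorem unitaryLike_parFwdV [NormOneClass 𝔸] {U : CfgV1 P 𝔸} (hU : ∀ μ x, UnitaryLike (U μ x)) (κ : Fin P.d) :
    ∀ (n : ℕ) (w : Site P 0), UnitaryLike (parFwdV U κ n w)
  | 0, _ => T4RelativeLadder.UnitaryLike.one
  | n + 1, w => by rw [parFwdV_succ]; exact (hU κ w).mul (unitaryLike_parFwdV hU κ n _)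

/-- ★ **THE ONE-STEP RECURSION**: with `Θ_n := U(l ++ K_n)·U(K_n ++ l)⁻¹`, `Θ_{n+1} = Θ_n · (G_n · Λ_n · G_n⁻¹)` where `G_n = U(K_n)` is the straight run from `w` and `Λ_n` the lasso of
`l` from `w + n e_κ` (`B9Eq340StepLasso.stepLasso`). [cite: Balaban1985BackgroundPropagators, (3.40) p.397, (3.3) p.391, bookkeeping] -/
theorem moveBlock_succ (U : CfgV1 P 𝔸) (κ : Fin P.d) (l : List (Fin P.d × Bool)) (n : ℕ) (w : Site P 0) :
    stepRun U (l ++ List.replicate (n + 1) (κ, true)) w * (stepRun U (List.replicate (n + 1) (κ, true) ++ l) w)⁻¹ =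
      (stepRun U (l ++ List.replicate n (κ, true)) w * (stepRun U (List.replicate n (κ, true) ++ l) w)⁻¹) *
        (parFwdV U κ n w * stepLasso κ U l ((fun y : Site P 0 => y.shift κ)^[n] w) * (parFwdV U κ n w)⁻¹) := by
  rw [stepRun_path_block, stepRun_path_block, stepRun_block_path, stepRun_block_path, parFwdV_succ_right, parFwdV_succ_right,
    Function.iterate_succ_apply']
  simp only [stepLasso, stepEnd_iterate_shift, mul_inv_rev]
  group

/-- ★★ **MOVING A FORWARD BLOCK PAST A SIGNED STEP PATH COSTS THE PLAQUETTES IT SWEEPS**: for unitary-like bond variables, every signed step path `l`, direction `κ` and `n`,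
`‖U(l ++ (κ,+)^n)·U((κ,+)^n ++ l)⁻¹ − 1‖ ≤ Σ_{t<n} stepDefect κ U l (w + t e_κ)` — `n` lassos (`norm_stepLasso_sub_one_le`), each conjugated by the unitary-like straight run,
accumulated by `norm_mul_sub_one_le`. [cite: Balaban1985BackgroundPropagators, (3.40) p.397, (3.35) p.396; Balaban1985Averaging, (44)–(47) pp.24–25] -/
theorem norm_moveBlock_sub_one_le [NormOneClass 𝔸] {U : CfgV1 P 𝔸} (hU : ∀ μ x, UnitaryLike (U μ x)) (κ : Fin P.d) (l : List (Fin P.d × Bool)) (w : Site P 0) :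
    ∀ n : ℕ, ‖((stepRun U (l ++ List.replicate n (κ, true)) w * (stepRun U (List.replicate n (κ, true) ++ l) w)⁻¹ : 𝔸ˣ) : 𝔸) - 1‖ ≤
      ∑ t ∈ Finset.range n, stepDefect κ U l ((fun y : Site P 0 => y.shift κ)^[t] w)
  | 0 => by simp
  | n + 1 => by
    rw [moveBlock_succ, Finset.sum_range_succ]
    have hΘ : UnitaryLike (stepRun U (l ++ List.replicate n (κ, true)) w * (stepRun U (List.replicate n (κ, true) ++ l) w)⁻¹) :=
      (unitaryLike_stepRun hU _ _).mul (unitaryLike_stepRun hU _ _).inv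
    have hG := unitaryLike_parFwdV hU κ n w
    have hconj : ‖((parFwdV U κ n w * stepLasso κ U l ((fun y : Site P 0 => y.shift κ)^[n] w) * (parFwdV U κ n w)⁻¹ : 𝔸ˣ) : 𝔸) - 1‖ =
        ‖(stepLasso κ U l ((fun y : Site P 0 => y.shift κ)^[n] w) : 𝔸) - 1‖ := by
      rw [Units.val_mul, Units.val_mul]; exact norm_conj_sub_one_eq hG _
    calc _ ≤ ‖((stepRun U (l ++ List.replicate n (κ, true)) w * (stepRun U (List.replicate n (κ, true) ++ l) w)⁻¹ : 𝔸ˣ) : 𝔸) - 1‖ +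
          ‖((parFwdV U κ n w * stepLasso κ U l ((fun y : Site P 0 => y.shift κ)^[n] w) * (parFwdV U κ n w)⁻¹ : 𝔸ˣ) : 𝔸) - 1‖ :=
          norm_mul_sub_one_le hΘ.1
      _ ≤ _ := by
          rw [hconj]
          exact add_le_add (norm_moveBlock_sub_one_le hU κ l w n) (norm_stepLasso_sub_one_le hU κ l _)

/-- ★ **LOCALISED UNIFORM FORM**: if every plaquette variable BASED AT A SITE OF `Q` is within `δ` of `1`, and every rung site of the translated paths `l + t e_κ`, `t < n`, lies in
`Q`, the block move costs at most `n·|l|·δ`. [cite: Balaban1985BackgroundPropagators, (3.40) p.397, (3.35) p.396] -/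
theorem norm_moveBlock_sub_one_le_of_rungs [NormOneClass 𝔸] {U : CfgV1 P 𝔸} (hU : ∀ μ x, UnitaryLike (U μ x)) {Q : Site P 0 → Prop} {δ : ℝ}
    (hδ : ∀ (μ ν : Fin P.d) (v : Site P 0), Q v → ‖(plaqU (shiftsV1 P) U μ ν v : 𝔸) - 1‖ ≤ δ)
    (κ : Fin P.d) (l : List (Fin P.d × Bool)) (w : Site P 0) (n : ℕ)
    (hQ : ∀ t, t < n → ∀ r ∈ rungSites l ((fun y : Site P 0 => y.shift κ)^[t] w), Q r.1) :
    ‖((stepRun U (l ++ List.replicate n (κ, true)) w * (stepRun U (List.replicate n (κ, true) ++ l) w)⁻¹ : 𝔸ˣ) : 𝔸) - 1‖ ≤ n * (l.length * δ) := by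
  refine (norm_moveBlock_sub_one_le hU κ l w n).trans ?_
  have hstep : ∀ t ∈ Finset.range n, stepDefect κ U l ((fun y : Site P 0 => y.shift κ)^[t] w) ≤ l.length * δ := fun t ht =>
    stepDefect_le_of_forall κ U l _ fun r hr => hδ _ _ _ (hQ t (Finset.mem_range.1 ht) r hr)
  calc _ ≤ ∑ _t ∈ Finset.range n, (l.length : ℝ) * δ := Finset.sum_le_sum hstep
    _ = n * (l.length * δ) := by rw [Finset.sum_const, Finset.card_range, nsmul_eq_mul]

/-- ★ **UNIFORM FORM**: if every plaquette variable is within `δ` of `1`, the block move costs at most `n·|l|·δ`. [cite: Balaban1985BackgroundPropagators, (3.40) p.397, (3.35) p.396] -/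
theorem norm_moveBlock_sub_one_le_mul [NormOneClass 𝔸] {U : CfgV1 P 𝔸} (hU : ∀ μ x, UnitaryLike (U μ x)) {δ : ℝ}
    (hδ : ∀ (μ ν : Fin P.d) (v : Site P 0), ‖(plaqU (shiftsV1 P) U μ ν v : 𝔸) - 1‖ ≤ δ)
    (κ : Fin P.d) (l : List (Fin P.d × Bool)) (w : Site P 0) (n : ℕ) :
    ‖((stepRun U (l ++ List.replicate n (κ, true)) w * (stepRun U (List.replicate n (κ, true) ++ l) w)⁻¹ : 𝔸ˣ) : 𝔸) - 1‖ ≤ n * (l.length * δ) :=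
  norm_moveBlock_sub_one_le_of_rungs hU (Q := fun _ => True) (fun μ ν v _ => hδ μ ν v) κ l w n (fun _ _ _ _ => trivial)

/-! ## §2 Reversing a signed step path; backward blocks -/

/-- the REVERSED path: steps in reverse order, each traversed against its sign. [cite: Balaban1985BackgroundPropagators, (3.5) p.391 («U(−Γ) = U(Γ)⁻¹»), dictionary] -/
def revNeg (l : List (Fin P.d × Bool)) : List (Fin P.d × Bool) := (l.map fun s => (s.1, !s.2)).reverse

/-- reversal is an anti-homomorphism for concatenation. [cite: Balaban1985BackgroundPropagators, (3.5) p.391, bookkeeping] -/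
theorem revNeg_append (l₁ l₂ : List (Fin P.d × Bool)) : revNeg (l₁ ++ l₂) = revNeg l₂ ++ revNeg l₁ := by
  simp [revNeg, List.map_append, List.reverse_append]

/-- one more step in front becomes one opposite step at the back. [cite: Balaban1985BackgroundPropagators, (3.5) p.391, bookkeeping] -/
theorem revNeg_cons (s : Fin P.d × Bool) (l : List (Fin P.d × Bool)) : revNeg (s :: l) = revNeg l ++ [(s.1, !s.2)] := by
  simp [revNeg]

/-- the reverse of a straight block is the opposite straight block. [cite: Balaban1985BackgroundPropagators, (3.5) p.391, bookkeeping] -/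
theorem revNeg_replicate (n : ℕ) (ν : Fin P.d) (b : Bool) : revNeg (List.replicate n (ν, b)) = List.replicate n (ν, !b) := by
  simp [revNeg, List.map_replicate]

/-- the reverse of a forward block is the backward block. [cite: Balaban1985BackgroundPropagators, (3.5) p.391, bookkeeping] -/
theorem revNeg_replicate_true (n : ℕ) (ν : Fin P.d) : revNeg (List.replicate n (ν, true)) = List.replicate n (ν, false) :=
  revNeg_replicate n ν true

/-- the reverse of a backward block is the forward block. [cite: Balaban1985BackgroundPropagators, (3.5) p.391, bookkeeping] -/
theorem revNeg_replicate_false (n : ℕ) (ν : Fin P.d) : revNeg (List.replicate n (ν, false)) = List.replicate n (ν, true) :=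
  revNeg_replicate n ν false

/-- `|revNeg l| = |l|`. [cite: Balaban1985BackgroundPropagators, (3.5) p.391, bookkeeping] -/
theorem length_revNeg (l : List (Fin P.d × Bool)) : (revNeg l).length = l.length := by
  simp [revNeg]

/-- the reversed path leads back to the start. [cite: Balaban1985BackgroundPropagators, (3.5) p.391, bookkeeping] -/
theorem stepEnd_revNeg : ∀ (l : List (Fin P.d × Bool)) (w : Site P 0), stepEnd (revNeg l) (stepEnd l w) = w
  | [], _ => rfl
  | (ν, true) :: l, w => by
    rw [revNeg_cons]; simp only [stepEnd, Bool.not_true]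
    rw [stepEnd_append, stepEnd_revNeg l]; simp only [stepEnd]; exact unshift_shift w ν
  | (ν, false) :: l, w => by
    rw [revNeg_cons]; simp only [stepEnd, Bool.not_false]
    rw [stepEnd_append, stepEnd_revNeg l]; simp only [stepEnd]; exact shift_unshift w ν

/-- ★ **`U(−Γ) = U(Γ)⁻¹`**: the transporter along the reversed path from the endpoint is the inverse. [cite: Balaban1985BackgroundPropagators, (3.5) p.391] -/
theorem stepRun_revNeg (U : CfgV1 P 𝔸) : ∀ (l : List (Fin P.d × Bool)) (w : Site P 0), stepRun U (revNeg l) (stepEnd l w) = (stepRun U l w)⁻¹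
  | [], _ => by simp [revNeg, stepRun]
  | (ν, true) :: l, w => by
    rw [revNeg_cons]; simp only [stepRun, stepEnd, Bool.not_true]
    rw [stepRun_append, stepRun_revNeg U l, stepEnd_revNeg]; simp only [stepRun, unshift_shift, mul_one, mul_inv_rev]
  | (ν, false) :: l, w => by
    rw [revNeg_cons]; simp only [stepRun, stepEnd, Bool.not_false]
    rw [stepRun_append, stepRun_revNeg U l, stepEnd_revNeg]; simp only [stepRun, mul_one, mul_inv_rev, inv_inv]

/-- the endpoint of a backward `κ`-block is the `n`-fold unshift. [cite: Balaban1985BackgroundPropagators, (3.40) p.397, bookkeeping] -/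
theorem stepEnd_blockBwd (κ : Fin P.d) (n : ℕ) (w : Site P 0) :
    stepEnd (List.replicate n (κ, false)) w = (fun y : Site P 0 => y.unshift κ)^[n] w :=
  B9Eq340StepLasso.stepEnd_replicate_false κ n w

/-- shifting `n` times then unshifting `n` times is the identity. [cite: Balaban1985BackgroundPropagators, (3.1) p.390, bookkeeping] -/
theorem iterate_shift_iterate_unshift (κ : Fin P.d) : ∀ (n : ℕ) (w : Site P 0),
    (fun y : Site P 0 => y.shift κ)^[n] ((fun y : Site P 0 => y.unshift κ)^[n] w) = w
  | 0, _ => rfl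
  | n + 1, w => by
    rw [Function.iterate_succ_apply, Function.iterate_succ_apply', shift_unshift, iterate_shift_iterate_unshift κ n]

/-- ★ a backward block from `w` is the inverse of the forward block from `w − n e_κ`. [cite: Balaban1985BackgroundPropagators, (3.5) p.391, bookkeeping] -/
theorem stepRun_blockBwd_eq_inv (U : CfgV1 P 𝔸) (κ : Fin P.d) (n : ℕ) (w : Site P 0) :
    stepRun U (List.replicate n (κ, false)) w = (stepRun U (List.replicate n (κ, true)) ((fun y : Site P 0 => y.unshift κ)^[n] w))⁻¹ := by
  rw [← revNeg_replicate_true n κ, ← stepRun_revNeg U (List.replicate n (κ, true)) ((fun y : Site P 0 => y.unshift κ)^[n] w), stepEnd_block,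
    iterate_shift_iterate_unshift]

/-- translating the start backwards translates the end backwards. [cite: Balaban1985BackgroundPropagators, (3.1) p.390, bookkeeping] -/
theorem stepEnd_unshift (κ : Fin P.d) (l : List (Fin P.d × Bool)) (w : Site P 0) : stepEnd l (w.unshift κ) = (stepEnd l w).unshift κ := by
  have h := stepEnd_shift κ l (w.unshift κ)
  rw [shift_unshift] at h
  rw [h, unshift_shift]

/-- translating the start `n` times backwards translates the end `n` times backwards. [cite: Balaban1985BackgroundPropagators, (3.1) p.390, bookkeeping] -/
theorem stepEnd_iterate_unshift (κ : Fin P.d) (l : List (Fin P.d × Bool)) : ∀ (n : ℕ) (w : Site P 0),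
    stepEnd l ((fun y : Site P 0 => y.unshift κ)^[n] w) = (fun y : Site P 0 => y.unshift κ)^[n] (stepEnd l w)
  | 0, _ => rfl
  | n + 1, w => by
    rw [Function.iterate_succ_apply', Function.iterate_succ_apply', stepEnd_unshift, stepEnd_iterate_unshift κ l n w]

/-- ★★ **MOVING A BACKWARD BLOCK PAST A SIGNED STEP PATH** — the backward twin of `norm_moveBlock_sub_one_le_of_rungs`, by the identity `Θ⁻(w) = C⁻¹·Θ⁺(w − n e_κ)⁻¹·C`
(`C` the forward block from `w − n e_κ`): the cost is `n·|l|·δ` when every rung site of the paths `l − s e_κ`, `1 ≤ s ≤ n`, lies in `Q`.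
[cite: Balaban1985BackgroundPropagators, (3.40) p.397, (3.35) p.396, (3.5) p.391] -/
theorem norm_moveBlockBwd_sub_one_le_of_rungs [NormOneClass 𝔸] {U : CfgV1 P 𝔸} (hU : ∀ μ x, UnitaryLike (U μ x)) {Q : Site P 0 → Prop} {δ : ℝ}
    (hδ : ∀ (μ ν : Fin P.d) (v : Site P 0), Q v → ‖(plaqU (shiftsV1 P) U μ ν v : 𝔸) - 1‖ ≤ δ)
    (κ : Fin P.d) (l : List (Fin P.d × Bool)) (w : Site P 0) (n : ℕ)
    (hQ : ∀ t, t < n → ∀ r ∈ rungSites l ((fun y : Site P 0 => y.shift κ)^[t] ((fun y : Site P 0 => y.unshift κ)^[n] w)), Q r.1) :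
    ‖((stepRun U (l ++ List.replicate n (κ, false)) w * (stepRun U (List.replicate n (κ, false) ++ l) w)⁻¹ : 𝔸ˣ) : 𝔸) - 1‖ ≤ n * (l.length * δ) := by
  set w' : Site P 0 := (fun y : Site P 0 => y.unshift κ)^[n] w with hw'
  have hww : (fun y : Site P 0 => y.shift κ)^[n] w' = w := iterate_shift_iterate_unshift κ n w
  -- the four unitary pieces
  set A : 𝔸ˣ := stepRun U l w' with hA
  set Bk : 𝔸ˣ := stepRun U (List.replicate n (κ, true)) (stepEnd l w') with hBk
  set C : 𝔸ˣ := stepRun U (List.replicate n (κ, true)) w' with hC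
  set D : 𝔸ˣ := stepRun U l w with hD
  have hfwd1 : stepRun U (l ++ List.replicate n (κ, true)) w' = A * Bk := by rw [stepRun_append]
  have hfwd2 : stepRun U (List.replicate n (κ, true) ++ l) w' = C * D := by rw [stepRun_append, stepEnd_block, hww]
  have hbwd1 : stepRun U (l ++ List.replicate n (κ, false)) w = D * Bk⁻¹ := by
    rw [stepRun_append, stepRun_blockBwd_eq_inv, ← stepEnd_iterate_unshift]
  have hbwd2 : stepRun U (List.replicate n (κ, false) ++ l) w = C⁻¹ * A := by
    rw [stepRun_append, stepRun_blockBwd_eq_inv, stepEnd_blockBwd]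
  have hΘ := norm_moveBlock_sub_one_le_of_rungs hU hδ κ l w' n hQ
  rw [hfwd1, hfwd2] at hΘ
  rw [hbwd1, hbwd2]
  have hid : D * Bk⁻¹ * (C⁻¹ * A)⁻¹ = C⁻¹ * (A * Bk * (C * D)⁻¹)⁻¹ * (C⁻¹)⁻¹ := by simp only [mul_inv_rev, inv_inv]; group
  rw [hid]
  have hCu : UnitaryLike C⁻¹ := (unitaryLike_stepRun hU _ _).inv
  have hΘu : UnitaryLike (A * Bk * (C * D)⁻¹) :=
    ((unitaryLike_stepRun hU _ _).mul (unitaryLike_stepRun hU _ _)).mul ((unitaryLike_stepRun hU _ _).mul (unitaryLike_stepRun hU _ _)).inv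
  rw [Units.val_mul, Units.val_mul, norm_conj_sub_one_eq hCu]
  exact (norm_inv_sub_one_le hΘu).trans hΘ

/-! ## §3 One leg of def-Y's taxicab: either regime -/

/-- in the forward regime the leg is the forward block of `(t − c).val` steps. [cite: Balaban1985BackgroundPropagators, (3.40) p.397, dictionary] -/
theorem legSteps_of_le (ν : Fin P.d) {c t : ZMod (P.sitesPerDir 0)} (h : (t - c).val ≤ (c - t).val) :
    legSteps (P := P) ν c t = List.replicate (t - c).val (ν, true) := by
  unfold legSteps; rw [if_pos h]

/-- in the backward regime the leg is the backward block of `(c − t).val` steps. [cite: Balaban1985BackgroundPropagators, (3.40) p.397, dictionary] -/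
theorem legSteps_of_not_le (ν : Fin P.d) {c t : ZMod (P.sitesPerDir 0)} (h : ¬ (t - c).val ≤ (c - t).val) :
    legSteps (P := P) ν c t = List.replicate (c - t).val (ν, false) := by
  unfold legSteps; rw [if_neg h]

/-- the sites ON the forward leg have `ν`-coordinate on the shorter arc. [cite: Balaban1985BackgroundPropagators, (3.40) p.397, bookkeeping] -/
theorem onArc_add_of_le {n : ℕ} [NeZero n] {c t : ZMod n} (h : (t - c).val ≤ (c - t).val) {m : ℕ} (hm : m ≤ (t - c).val) :
    B9Eq340TaxiRungs.OnArc c t (c + m) := by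
  unfold B9Eq340TaxiRungs.OnArc
  rw [if_pos h, add_sub_cancel_left, ZMod.val_natCast]
  exact (Nat.mod_le _ _).trans hm

/-- the sites ON the backward leg have `ν`-coordinate on the shorter arc. [cite: Balaban1985BackgroundPropagators, (3.40) p.397, bookkeeping] -/
theorem onArc_sub_of_not_le {n : ℕ} [NeZero n] {c t : ZMod n} (h : ¬ (t - c).val ≤ (c - t).val) {m : ℕ} (hm : m ≤ (c - t).val) :
    B9Eq340TaxiRungs.OnArc c t (c - m) := by
  unfold B9Eq340TaxiRungs.OnArc
  rw [if_neg h, sub_sub_cancel, ZMod.val_natCast]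
  exact (Nat.mod_le _ _).trans hm

/-- ★★ **MOVING ONE TAXICAB LEG PAST A SIGNED STEP PATH**: for the leg in direction `ν` from `w` towards the coordinate `t` (either regime), if every plaquette based at a site of `Q`
is within `δ` of `1` and every rung site of the path `l` started from a site of the leg (coordinates off `ν` those of `w`, `ν`-coordinate on the shorter arc) lies in `Q`, then
`‖U(l ++ leg)·U(leg ++ l)⁻¹ − 1‖ ≤ |leg|·|l|·δ`. [cite: Balaban1985BackgroundPropagators, (3.40) p.397 («a shortest contour»), (3.35) p.396] -/
theorem norm_moveLeg_sub_one_le [NormOneClass 𝔸] {U : CfgV1 P 𝔸} (hU : ∀ μ x, UnitaryLike (U μ x)) {Q : Site P 0 → Prop} {δ : ℝ}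
    (hδ : ∀ (μ ν : Fin P.d) (v : Site P 0), Q v → ‖(plaqU (shiftsV1 P) U μ ν v : 𝔸) - 1‖ ≤ δ)
    (ν : Fin P.d) (t : ZMod (P.sitesPerDir 0)) (l : List (Fin P.d × Bool)) (w : Site P 0)
    (hQ : ∀ v : Site P 0, (∀ μ, μ ≠ ν → v μ = w μ) → B9Eq340TaxiRungs.OnArc (w ν) t (v ν) → ∀ r ∈ rungSites l v, Q r.1) :
    ‖((stepRun U (l ++ legSteps ν (w ν) t) w * (stepRun U (legSteps ν (w ν) t ++ l) w)⁻¹ : 𝔸ˣ) : 𝔸) - 1‖ ≤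
      (legSteps ν (w ν) t).length * (l.length * δ) := by
  by_cases hreg : (t - w ν).val ≤ (w ν - t).val
  · rw [legSteps_of_le ν hreg, List.length_replicate]
    refine norm_moveBlock_sub_one_le_of_rungs hU hδ ν l w _ fun s hs r hr => hQ _ (fun μ hμ => ?_) ?_ r hr
    · rw [iterate_shift_apply, if_neg hμ]
    · rw [iterate_shift_apply, if_pos rfl]; exact onArc_add_of_le hreg hs.le
  · rw [legSteps_of_not_le ν hreg, List.length_replicate]
    refine norm_moveBlockBwd_sub_one_le_of_rungs hU hδ ν l w _ fun s hs r hr => hQ _ (fun μ hμ => ?_) ?_ r hr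
    · rw [iterate_shift_apply, if_neg hμ, iterate_unshift_apply, if_neg hμ]
    · rw [iterate_shift_apply, if_pos rfl, iterate_unshift_apply, if_pos rfl, sub_add]
      have hcast : ((((w ν - t).val : ℕ) : ZMod (P.sitesPerDir 0)) - ((s : ℕ) : ZMod (P.sitesPerDir 0))) = (((w ν - t).val - s : ℕ) : ZMod (P.sitesPerDir 0)) := by
        rw [Nat.cast_sub hs.le]
      rw [hcast]
      haveI : NeZero (P.sitesPerDir 0) := ⟨(Nat.lt_of_lt_of_le Nat.zero_lt_one (P.one_lt_sitesPerDir 0).le).ne'⟩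
      exact onArc_sub_of_not_le hreg (Nat.sub_le _ _)

/-! ## §4 The two staircases between two sites -/

/-- legs over a concatenated direction list concatenate. [cite: Balaban1985BackgroundPropagators, (3.40) p.397, bookkeeping] -/
theorem taxiSteps_append (l₁ l₂ : List (Fin P.d)) (p z : Site P 0) : taxiSteps (l₁ ++ l₂) p z = taxiSteps l₁ p z ++ taxiSteps l₂ p z := by
  induction l₁ with
  | nil => rfl
  | cons ν l ih => rw [List.cons_append]; simp only [taxiSteps]; rw [ih, List.append_assoc]

/-- the single-direction list gives one leg. [cite: Balaban1985BackgroundPropagators, (3.40) p.397, bookkeeping] -/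
theorem taxiSteps_singleton (ν : Fin P.d) (p z : Site P 0) : taxiSteps [ν] p z = legSteps ν (p ν) (z ν) := by
  simp only [taxiSteps, List.append_nil]

/-- reversing `ν :: l` puts the `ν`-leg LAST. [cite: Balaban1985BackgroundPropagators, (3.40) p.397, bookkeeping] -/
theorem taxiSteps_reverse_cons (ν : Fin P.d) (l : List (Fin P.d)) (p z : Site P 0) :
    taxiSteps (ν :: l).reverse p z = taxiSteps l.reverse p z ++ legSteps ν (p ν) (z ν) := by
  rw [List.reverse_cons, taxiSteps_append, taxiSteps_singleton]

/-- both staircases have the same number of steps. [cite: Balaban1985BackgroundPropagators, (3.40) p.397, bookkeeping] -/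
theorem length_taxiSteps_reverse (l : List (Fin P.d)) (p z : Site P 0) : (taxiSteps l.reverse p z).length = (taxiSteps l p z).length := by
  rw [B9Eq340TaxiTelescope.length_taxiSteps_eq_sum, B9Eq340TaxiTelescope.length_taxiSteps_eq_sum]
  exact List.Perm.sum_eq (List.Perm.map _ (List.reverse_perm l))

/-- ★★★ **THE TWO STAIRCASES DIFFER BY THE PLAQUETTES IN THE BOX BETWEEN THEIR ENDPOINTS**: for unitary-like bond variables, a duplicate-free direction list `dirs`, and every
plaquette variable based at a site of the coordinate box `{v : ∀ μ, v_μ on the shorter arc from x_μ to z_μ}` within `δ ≥ 0` of `1`: the staircase from `x` towards `z` in the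
order `dirs` and the staircase in the REVERSED order satisfy `‖U(Γ)·U(Γ′)⁻¹ − 1‖ ≤ |Γ|²·δ` (`|Γ|` = the common number of steps; legs of either regime).  Induction on
`dirs = ν :: l`: `Γ = B_ν ++ T`, `Γ′ = T′ ++ B_ν`; §3 moves `B_ν` to the front of `Γ′` (cost `n_ν·|T′|·δ`, its rungs in the box by n06-i's `rungSites_taxiSteps`), and
`U(B_ν)·(U(T)U(T′)⁻¹)·U(B_ν)⁻¹` is the induction hypothesis at the leg's endpoint (the later legs do not read the `ν`-coordinate, `taxiSteps_congr`; their box is inside ours).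
[cite: Balaban1985BackgroundPropagators, (3.40) p.397 («a shortest contour»), (3.35) p.396; Balaban1985Averaging, (44)–(47) pp.24–25] -/
theorem norm_twoRoute_sub_one_le [NormOneClass 𝔸] {U : CfgV1 P 𝔸} (hU : ∀ μ x, UnitaryLike (U μ x)) {δ : ℝ} (hδ0 : 0 ≤ δ) (z : Site P 0) :
    ∀ (dirs : List (Fin P.d)), dirs.Nodup → ∀ x : Site P 0,
      (∀ (μ ν : Fin P.d) (v : Site P 0), (∀ κ, B9Eq340TaxiRungs.OnArc (x κ) (z κ) (v κ)) → ‖(plaqU (shiftsV1 P) U μ ν v : 𝔸) - 1‖ ≤ δ) →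
      ‖((stepRun U (taxiSteps dirs x z) x * (stepRun U (taxiSteps dirs.reverse x z) x)⁻¹ : 𝔸ˣ) : 𝔸) - 1‖ ≤
        ((taxiSteps dirs x z).length : ℝ) ^ 2 * δ
  | [], _, x, _ => by simp [taxiSteps, stepRun]
  | ν :: l, hnd, x, hδ => by
    rw [List.nodup_cons] at hnd
    have hνl : ν ∉ l := hnd.1
    set Bν := legSteps ν (x ν) (z ν) with hBν
    set T := taxiSteps l x z with hT
    set T' := taxiSteps l.reverse x z with hT'
    have hΓ : taxiSteps (ν :: l) x z = Bν ++ T := rfl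
    have hΓ' : taxiSteps (ν :: l).reverse x z = T' ++ Bν := by rw [taxiSteps_reverse_cons]
    -- the leg's endpoint and the induction hypothesis there
    set x₁ : Site P 0 := stepEnd Bν x with hx₁
    have hx₁c : ∀ μ, μ ≠ ν → x₁ μ = x μ := fun μ hμ => B9Eq340StepLasso.stepEnd_legSteps_apply_of_ne ν _ _ x hμ
    have hx₁ν : x₁ ν = z ν := B9Eq340TaxiRungs.stepEnd_legSteps_apply_self ν rfl
    have hx₁l : ∀ μ ∈ l, x₁ μ = x μ := fun μ hμ => hx₁c μ (fun h => hνl (h ▸ hμ))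
    have hTx₁ : taxiSteps l x₁ z = T := taxiSteps_congr hx₁l (fun _ _ => rfl)
    have hT'x₁ : taxiSteps l.reverse x₁ z = T' := taxiSteps_congr (fun μ hμ => hx₁l μ (List.mem_reverse.1 hμ)) (fun _ _ => rfl)
    -- the smaller box is inside the box
    have hbox₁ : ∀ v : Site P 0, (∀ κ, B9Eq340TaxiRungs.OnArc (x₁ κ) (z κ) (v κ)) → ∀ κ, B9Eq340TaxiRungs.OnArc (x κ) (z κ) (v κ) := by
      intro v hv κ
      by_cases hκ : κ = ν
      · subst hκ
        have h := hv κ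
        rw [hx₁ν] at h
        -- `OnArc (z κ) (z κ) (v κ)` forces `v κ = z κ`
        have hv0 : v κ = z κ := by
          unfold B9Eq340TaxiRungs.OnArc at h
          rw [sub_self, ZMod.val_zero, if_pos le_rfl] at h
          have h0 : (v κ - z κ).val = 0 := Nat.le_zero.1 h
          rwa [ZMod.val_eq_zero, sub_eq_zero] at h0
        rw [hv0]; exact B9Eq340TaxiRungs.onArc_right _ _
      · have h := hv κ; rwa [hx₁c κ hκ] at h
    have IH := norm_twoRoute_sub_one_le hU hδ0 z l hnd.2 x₁ (fun μ ν' v hv => hδ μ ν' v (hbox₁ v hv))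
    rw [hTx₁, hT'x₁] at IH
    -- moving the leg past `T′`: its rungs lie in the box
    have hmove : ‖((stepRun U (T' ++ Bν) x * (stepRun U (Bν ++ T') x)⁻¹ : 𝔸ˣ) : 𝔸) - 1‖ ≤ Bν.length * (T'.length * δ) := by
      refine norm_moveLeg_sub_one_le hU (Q := fun v => ∀ κ, B9Eq340TaxiRungs.OnArc (x κ) (z κ) (v κ)) hδ ν (z ν) T' x ?_
      intro v hvμ hvν r hr κ
      have hT'v : taxiSteps l.reverse v z = T' := taxiSteps_congr (fun μ hμ => hvμ μ (fun h => hνl (h ▸ List.mem_reverse.1 hμ))) (fun _ _ => rfl)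
      rw [← hT'v] at hr
      obtain ⟨-, hoff, hon⟩ := B9Eq340TaxiRungs.rungSites_taxiSteps z l.reverse (List.nodup_reverse.2 hnd.2) v r hr
      by_cases hκl : κ ∈ l.reverse
      · have h := (hon κ hκl).1
        rwa [hvμ κ (fun h => hνl (h ▸ List.mem_reverse.1 hκl))] at h
      · rw [(hoff κ hκl).1]
        by_cases hκν : κ = ν
        · subst hκν; exact hvν
        · rw [hvμ κ hκν]; exact B9Eq340TaxiRungs.onArc_left _ _
    -- lengths
    have hlenT' : T'.length = T.length := length_taxiSteps_reverse l x z
    have hlenΓ : (taxiSteps (ν :: l) x z).length = Bν.length + T.length := by rw [hΓ, List.length_append]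
    -- the algebra: `U(Γ)U(Γ′)⁻¹ = [G (U(T)U(T′)⁻¹) G⁻¹] · Θ⁻¹`, `G = U(B_ν)`, `Θ = U(T′ ++ B)U(B ++ T′)⁻¹`
    set G : 𝔸ˣ := stepRun U Bν x with hG
    set Θ : 𝔸ˣ := stepRun U (T' ++ Bν) x * (stepRun U (Bν ++ T') x)⁻¹ with hΘ
    have hprod : stepRun U (taxiSteps (ν :: l) x z) x * (stepRun U (taxiSteps (ν :: l).reverse x z) x)⁻¹ =
        (G * (stepRun U T x₁ * (stepRun U T' x₁)⁻¹) * G⁻¹) * Θ⁻¹ := by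
      rw [hΓ, hΓ', hΘ, stepRun_append U Bν T, stepRun_append U Bν T', ← hx₁, ← hG]
      simp only [mul_inv_rev, inv_inv]
      group
    rw [hprod]
    have hGu : UnitaryLike G := unitaryLike_stepRun hU _ _
    have hin : UnitaryLike (stepRun U T x₁ * (stepRun U T' x₁)⁻¹) := (unitaryLike_stepRun hU _ _).mul (unitaryLike_stepRun hU _ _).inv
    have hΘu : UnitaryLike Θ := (unitaryLike_stepRun hU _ _).mul (unitaryLike_stepRun hU _ _).inv
    have hconj : ‖((G * (stepRun U T x₁ * (stepRun U T' x₁)⁻¹) * G⁻¹ : 𝔸ˣ) : 𝔸) - 1‖ = ‖((stepRun U T x₁ * (stepRun U T' x₁)⁻¹ : 𝔸ˣ) : 𝔸) - 1‖ := by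
      rw [Units.val_mul, Units.val_mul]; exact norm_conj_sub_one_eq hGu _
    have h1 : ‖((G * (stepRun U T x₁ * (stepRun U T' x₁)⁻¹) * G⁻¹ * Θ⁻¹ : 𝔸ˣ) : 𝔸) - 1‖ ≤
        ((T.length : ℝ) ^ 2 * δ) + Bν.length * (T.length * δ) := by
      refine (norm_mul_sub_one_le ((hGu.mul hin).mul hGu.inv).1).trans ?_
      rw [hconj]
      refine add_le_add IH ((norm_inv_sub_one_le hΘu).trans ?_)
      rw [← hlenT']; exact hmove
    refine h1.trans ?_
    rw [hlenΓ]
    push_cast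
    have hT0 : (0 : ℝ) ≤ T.length := Nat.cast_nonneg _
    have hn0 : (0 : ℝ) ≤ Bν.length := Nat.cast_nonneg _
    nlinarith [mul_nonneg (mul_nonneg hn0 hn0) hδ0, mul_nonneg (mul_nonneg hn0 hT0) hδ0]

/-! ## §5 def-Y's two transporters of a pair: `U(Γ_{x,x′})·U(Γ_{x′,x}) ≈ 1` -/

/-- ★ **NO TIE ⇒ THE RETURN LEG IS THE REVERSED LEG**: if the two arcs between `c` and `t` have different lengths (or `c = t`), the leg from `t` back to `c` is the reverse of
the leg from `c` to `t`. [cite: Balaban1985BackgroundPropagators, (3.40) p.397 («a shortest contour»), bookkeeping] -/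
theorem revNeg_legSteps (ν : Fin P.d) {c t : ZMod (P.sitesPerDir 0)} (h : (t - c).val ≠ (c - t).val ∨ c = t) :
    revNeg (legSteps (P := P) ν t c) = legSteps ν c t := by
  rcases h with h | h
  · rcases lt_or_gt_of_ne h with hlt | hgt
    · rw [legSteps_of_le ν hlt.le, legSteps_of_not_le ν (not_le.2 hlt), revNeg_replicate]; rfl
    · rw [legSteps_of_not_le ν (not_le.2 hgt), legSteps_of_le ν hgt.le, revNeg_replicate]; rfl
  · subst h; simp [legSteps, revNeg]

/-- ★ **NO TIE ⇒ THE RETURN ROUTE IS THE REVERSED-ORDER STAIRCASE**: `revNeg (taxiSteps dirs x′ x) = taxiSteps dirs.reverse x x′`.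
[cite: Balaban1985BackgroundPropagators, (3.40) p.397, bookkeeping] -/
theorem revNeg_taxiSteps (x x' : Site P 0) (hnt : ∀ ν : Fin P.d, (x' ν - x ν).val ≠ (x ν - x' ν).val ∨ x ν = x' ν) :
    ∀ dirs : List (Fin P.d), revNeg (taxiSteps dirs x' x) = taxiSteps dirs.reverse x x'
  | [] => by simp [taxiSteps, revNeg]
  | ν :: l => by
    simp only [taxiSteps]
    rw [revNeg_append, revNeg_taxiSteps x x' hnt l, revNeg_legSteps ν (hnt ν), taxiSteps_reverse_cons]

/-- ★★ **THE RETURN TRANSPORTER IS THE INVERSE OF THE REVERSED-ORDER STAIRCASE**: with no tie in any direction, `U(Γ_{x′,x}) = U(taxiSteps (d−1,…,0) from x to x′)⁻¹`.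
[cite: Balaban1985BackgroundPropagators, (3.40) p.397, (3.5) p.391] -/
theorem parTaxiV_rev_eq_inv [NormOneClass 𝔸] (U : CfgV1 P 𝔸) (x x' : Site P 0)
    (hnt : ∀ ν : Fin P.d, (x' ν - x ν).val ≠ (x ν - x' ν).val ∨ x ν = x' ν) :
    parTaxiV U x' x = (stepRun U (taxiSteps (List.finRange P.d).reverse x x') x)⁻¹ := by
  rw [← revNeg_taxiSteps x x' hnt]
  have h := stepRun_revNeg U (taxiSteps (List.finRange P.d) x' x) x'
  rw [B9Eq340TaxiTelescope.stepEnd_taxiSteps x' x] at h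
  rw [h, inv_inv, B9Eq340StepLasso.parTaxiV_eq_stepRun]

/-- ★★★ **def-Y's TAXICAB TRANSPORTERS OF A PAIR COMPOSE TO THE IDENTITY UP TO THE PLAQUETTES IN THE BOX**: for unitary-like bond variables, a pair `x, x′` with no tie, and every
plaquette variable based in the coordinate box between `x` and `x′` within `δ ≥ 0` of `1`:
`‖U(Γ_{x,x′})·U(Γ_{x′,x}) − 1‖ ≤ |Γ_{x,x′}|²·δ ≤ (d·|x − x′|_∞)²·δ`. [cite: Balaban1985BackgroundPropagators, (3.40) p.397 («a shortest contour»), (3.35) p.396, (3.5) p.391] -/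
theorem norm_parTaxiV_mul_parTaxiV_sub_one_le [NormOneClass 𝔸] {U : CfgV1 P 𝔸} (hU : ∀ μ x, UnitaryLike (U μ x)) {δ : ℝ} (hδ0 : 0 ≤ δ)
    (x x' : Site P 0) (hnt : ∀ ν : Fin P.d, (x' ν - x ν).val ≠ (x ν - x' ν).val ∨ x ν = x' ν)
    (hδ : ∀ (μ ν : Fin P.d) (v : Site P 0), (∀ κ, B9Eq340TaxiRungs.OnArc (x κ) (x' κ) (v κ)) → ‖(plaqU (shiftsV1 P) U μ ν v : 𝔸) - 1‖ ≤ δ) :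
    ‖((parTaxiV U x x' * parTaxiV U x' x : 𝔸ˣ) : 𝔸) - 1‖ ≤ ((taxiSteps (List.finRange P.d) x x').length : ℝ) ^ 2 * δ := by
  rw [parTaxiV_rev_eq_inv U x x' hnt, B9Eq340StepLasso.parTaxiV_eq_stepRun]
  exact norm_twoRoute_sub_one_le hU hδ0 x' (List.finRange P.d) (List.nodup_finRange _) x hδ

/-- ★★★ **`ℓ^∞` FORM**: `‖U(Γ_{x,x′})·U(Γ_{x′,x}) − 1‖ ≤ (d·|x − x′|_∞)²·δ`. [cite: Balaban1985BackgroundPropagators, (3.40) p.397, (3.35) p.396] -/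
theorem norm_parTaxiV_mul_parTaxiV_sub_one_le_supDist [NormOneClass 𝔸] {U : CfgV1 P 𝔸} (hU : ∀ μ x, UnitaryLike (U μ x)) {δ : ℝ} (hδ0 : 0 ≤ δ)
    (x x' : Site P 0) (hnt : ∀ ν : Fin P.d, (x' ν - x ν).val ≠ (x ν - x' ν).val ∨ x ν = x' ν)
    (hδ : ∀ (μ ν : Fin P.d) (v : Site P 0), (∀ κ, B9Eq340TaxiRungs.OnArc (x κ) (x' κ) (v κ)) → ‖(plaqU (shiftsV1 P) U μ ν v : 𝔸) - 1‖ ≤ δ) :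
    ‖((parTaxiV U x x' * parTaxiV U x' x : 𝔸ˣ) : 𝔸) - 1‖ ≤ ((P.d : ℝ) * (LatticeFieldCalculus.supDist x x' : ℝ)) ^ 2 * δ := by
  refine (norm_parTaxiV_mul_parTaxiV_sub_one_le hU hδ0 x x' hnt hδ).trans (mul_le_mul_of_nonneg_right ?_ hδ0)
  have h : ((taxiSteps (List.finRange P.d) x x').length : ℝ) ≤ (P.d : ℝ) * (LatticeFieldCalculus.supDist x x' : ℝ) := by
    exact_mod_cast B9Eq340TaxiTelescope.length_taxiSteps_le_mul_supDist x x'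
  exact pow_le_pow_left₀ (Nat.cast_nonneg _) h 2

end

end Literature.MathematicalPhysics.QuantumFieldTheory.Balaban1983to89.B9Eq340TwoRouteHolonomy
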